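import Literature.AnabelianGeometry.EtaleTheta.Discharge.Sec3Thm37Holds
import Literature.AlgebraicGeometry.Frobenioids.ModelFrobenioidStandardProofs
import Literature.AlgebraicGeometry.Frobenioids.ModelFrobenioidBiratNormalized
import Literature.AlgebraicGeometry.Frobenioids.BiratLocalization
import HarnessLib

/-!
# [EtTh] Theorem 3.7 (ii), first clause — "`C` is of standard type" — DISCHARGED in the tree's
# [FrdI] Def 3.1 (i) vocabulary, via [FrdI] Thm 5.2 (iii); and Thm 3.7 (i) "birationally
# Frobenius-normalized type" via [FrdI] Thm 5.2 (ii)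

Proof-only sequel (theorems only, no definitions) of `Discharge/Sec3Thm37.lean` (abc-iut-L6-t13),
`Sec3Thm37SubQFT.lean` (abc-iut-L1-t1), `Sec3Thm37Holds.lean`. S. Mochizuki, *The étale theta
function …*, Publ. RIMS **45** (2009) [EtTh], §3, Theorem 3.7 (ii), p. 79 = PDF p. 305 of
`paper:doi-10-2977-prims-1234361159` [cite: MochizukiEtTh2009, Thm 3.7 (ii) p.79]:

> "(ii) Suppose `D` is of FSMFF-type, and that `Φ` is non-dilating. Then `C` is of standard type. If,
> moreover, `Φ` is rational [cf. Definition 3.6, (ii)], then `C` is of rationally standard type."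

and its proof, p. 80 = PDF p. 306: "Assertion (ii) follows immediately from [Mzk17], Theorem 5.2,
(iii)" ([Mzk17] = [FrdI]).

L2-t3's named `Prop` `TemperedFrobenioid.Thm37_ii F` states (ii) over the FACADE `F : FrobenioidFacade D`
whose fields "of standard type" / "of rationally standard type" are FREE predicates (TODO-merge: [FrdI]
Def 3.1 (i) / Def 4.5 (iii)) — not provable for an arbitrary facade and not touched here. But the
tempered Frobenioid IS the model Frobenioid `C₀.category = ModelFrobenioid Φ B Div_B` of [FrdI] Thm 5.2
(i) (`TemperedFrobenioidModel.lean`), [FrdI] Def 3.1 (i) "of standard type" IS in the tree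
(`Frobenioids.PreFrobenioidData.IsOfStandardType`, abc-iut-L1-t3) and [FrdI] Thm 5.2 (iii) IS PROVED
(`Frobenioids.ModelFrobenioid.standardTypeIff_holds`, abc-iut-L1-t2: a model Frobenioid is of standard
type iff (a) `Φ` zero ⇒ a Frobenius-compact object exists, (b) `D` of FSMFF-type, (c) `Φ`
non-dilating). So the CONTENT of the first clause of (ii) is kernel-checked here exactly along the
printed route:

* `not_isZeroMonoid_divisorMonoid` — the divisor monoid `Φ` of a tempered Frobenioid is NOT the zero
  monoid (Def 3.6 (ii)(b): `x ≠ y` in `Φ(A)`; `D` connected hence nonempty), so (a) of Thm 5.2 (iii)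
  is vacuous;
* `isOfStandardType_of` — `D` of FSMFF-type ∧ `Φ` non-dilating ⟹ `C` of standard type, modulo the
  standing-hypotheses bundle `ModelFrobenioid.Hypotheses Φ B` of [FrdI] Thm 5.2; and the converse
  `fsmff_and_nonDilating_of_isOfStandardType` (Thm 5.2 (iii) is an iff);
* at the CANONICAL [FrdI] vocabulary `treeCatVocab` (`FrdIVocabulary.lean`): `hypotheses_treeCatVocab`
  assembles that bundle from the fields of Def 3.6 (`isDivisorialOn`, `isConnected`,
  `isTotallyEpimorphic`, `RealifiedDivisorMonoids.isUnit_BΛ`) modulo the single residual datum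
  `hBmon : IsMonoidOn B` already named by `Sec3Thm37SubQFT.lean` ("`𝔹` a monoid on `D`", [FrdI] Thm 5.2
  preamble p. 99; not recorded by `RealifiedDivisorMonoids`), whence
  `isOfStandardType_treeCatVocab (hBmon) (hD) (hnd)` — **Thm 3.7 (ii), first clause, with inputs
  (`hBmon`, FSMFF, non-dilating) only**, and the reading of its non-dilating hypothesis in the shape
  L2-t3's `Thm37_ii` uses (`∀ (A : Dᵒᵖ) (f : A ⟶ A), V.IsNonDilating (Φ(A)) (Φ.pull f)`) at the canonical
  monoid vocabulary `treeMonoidVocab` (`isNonDilatingOn_iff_pull`).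

ALSO (Thm 3.7 (i), one more facade conjunct made real): "of … birationally Frobenius-normalized … type"
([FrdI] Def 4.5 (i)) — `isOfBiratFrobeniusNormalizedType_of` / `_treeCatVocab`: every object of the
tempered Frobenioid is birationally Frobenius-normalized AT THE birationalization `C^birat`
(`PreFrobenioid.biratData`, abc-iut-L6-t6/t8; square completion `hasBiratSquares_of_isFrobenioid`), by
L1-d10's PROVED [FrdI] Thm 5.2 (ii) clause `ModelFrobenioid.isOfBiratFrobeniusNormalizedType_of_isDivisorial`
— inputs `hF` (resp. `hBmon` at `treeCatVocab`) only. ("of model type" = pre-model ∧ this; the tree's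
pre-model-type theorem for model Frobenioids, `ModelFrobenioid.isOfPreModelType`, is stated for skeletal
`D` — not composed here.)

NOT touched (schema): the second clause "rational ⇒ rationally standard" — [FrdI] Def 4.5 (ii)(iii) /
Thm 5.2 (iii) second sentence are parametrised by the §2/§4 constructions `(C^un-tr)^birat`,
Frobenius-compactness therein (`ModelFrobenioid.RationallyStandardTypeIff`, labelled SCHEMA by its
author), so that clause has no closed instance to be proved at yet (TODO-merge abc-iut-L1-t3/t5).
HONEST FRAMING: refereed pre-IUT material ([EtTh] §3 over [FrdI] §3/§5); nothing here bears on
[IUTchIII] Cor. 3.12; no statement of either paper is strengthened; typed ≠ proved — here PROVED.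
-/

namespace Literature.AnabelianGeometry.EtaleTheta

open CategoryTheory Opposite Literature.AlgebraicGeometry.Frobenioids

universe u₀ v₀ u v w

variable {D₀ : Type u₀} [Category.{v₀} D₀] {V : FrdIMonoidStub.{w}}
  {T : RealifiedDivisorMonoids (D₀ := D₀) V} {D : Type u} [Category.{v} D]

namespace TemperedFrobenioid

section General

variable {VD : FrdICatStub.{u, v, w} D} (C₀ : TemperedFrobenioid T D VD)

/-- The divisor monoid `Φ` of a tempered Frobenioid is not the zero monoid: Def 3.6 (ii)(b) supplies
`x ≠ y` in `Φ(A)` for every `A ∈ Ob(D)`, and `D` is connected, hence nonempty ("the condition imposed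
on `F` in Definition 3.6, (ii), (b), implies immediately that `C` is not of group-like type", p. 306 —
the same observation). [cite: MochizukiEtTh2009, Thm 3.7 p.79] -/
theorem not_isZeroMonoid_divisorMonoid : ¬ ModelFrobenioid.IsZeroMonoid C₀.divisorMonoid := by
  intro h0
  haveI := C₀.isConnected
  obtain ⟨A⟩ := (inferInstance : IsConnected D).is_nonempty
  obtain ⟨-, -, x, hx, y, hy, hxy, -⟩ := C₀.exists_FΛ_div_ne (op A)
  have hx1 : (⟨x, hx⟩ : C₀.Φ.carrier (op A)) = 1 := h0 (op A) ⟨x, hx⟩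
  have hy1 : (⟨y, hy⟩ : C₀.Φ.carrier (op A)) = 1 := h0 (op A) ⟨y, hy⟩
  exact hxy ((congrArg Subtype.val hx1).trans (congrArg Subtype.val hy1).symm)

/-- **Thm 3.7 (ii), first clause, modulo the standing hypotheses of [FrdI] Thm 5.2** (`Φ` a divisorial
monoid on the connected, totally epimorphic `D`; `B` a group-like monoid on `D`): if `D` is of
FSMFF-type and `Φ` is non-dilating, then the tempered Frobenioid `C` is of standard type ([FrdI] Def 3.1
(i), the tree's `PreFrobenioidData.IsOfStandardType` at the data of the model Frobenioid) — "follows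
immediately from [Mzk17], Theorem 5.2, (iii)" (p. 306): condition (a) of loc. cit. is vacuous by
`not_isZeroMonoid_divisorMonoid`. [cite: MochizukiEtTh2009, Thm 3.7 (ii) p.79] -/
theorem isOfStandardType_of (hyp : ModelFrobenioid.Hypotheses C₀.divisorMonoid C₀.ratFnFunctor)
    (hD : IsOfFSMFFType D) (hnd : IsNonDilatingOn C₀.divisorMonoid) :
    (ModelFrobenioid.data C₀.divisorMonoid C₀.ratFnFunctor C₀.divBNatTrans).IsOfStandardType :=
  (ModelFrobenioid.standardTypeIff_holds C₀.divisorMonoid C₀.ratFnFunctor C₀.divBNatTrans hyp).mpr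
    ⟨fun h0 => absurd h0 C₀.not_isZeroMonoid_divisorMonoid, hD, hnd⟩

/-- Conversely (Thm 5.2 (iii) is an equivalence): if the tempered Frobenioid is of standard type then
`D` is of FSMFF-type and `Φ` is non-dilating — the hypotheses of Thm 3.7 (ii) are also necessary.
[cite: MochizukiEtTh2009, Thm 3.7 (ii) p.79] -/
theorem fsmff_and_nonDilating_of_isOfStandardType
    (hyp : ModelFrobenioid.Hypotheses C₀.divisorMonoid C₀.ratFnFunctor)
    (hs : (ModelFrobenioid.data C₀.divisorMonoid C₀.ratFnFunctor C₀.divBNatTrans).IsOfStandardType) :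
    IsOfFSMFFType D ∧ IsNonDilatingOn C₀.divisorMonoid :=
  let h := (ModelFrobenioid.standardTypeIff_holds C₀.divisorMonoid C₀.ratFnFunctor C₀.divBNatTrans hyp).mp hs
  ⟨h.2.1, h.2.2⟩

/-- **Thm 3.7 (ii), first clause, as an equivalence** modulo the Thm 5.2 hypotheses: `C` is of standard
type iff `D` is of FSMFF-type and `Φ` is non-dilating. [cite: MochizukiEtTh2009, Thm 3.7 (ii) p.79] -/
theorem isOfStandardType_iff (hyp : ModelFrobenioid.Hypotheses C₀.divisorMonoid C₀.ratFnFunctor) :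
    (ModelFrobenioid.data C₀.divisorMonoid C₀.ratFnFunctor C₀.divBNatTrans).IsOfStandardType ↔
      IsOfFSMFFType D ∧ IsNonDilatingOn C₀.divisorMonoid :=
  ⟨C₀.fsmff_and_nonDilating_of_isOfStandardType hyp, fun h => C₀.isOfStandardType_of hyp h.1 h.2⟩

/-- The non-dilating hypothesis in the tree's functorial form `IsNonDilatingOn Φ` ([FrdI] Def 1.1 (ii):
every pull-back `α^*` along an endomorphism `α` of an object of `D` is non-dilating) unfolds, for the
divisor monoid of a tempered Frobenioid, to "every `Φ.pull f`, `f` an endomorphism in `Dᵒᵖ`, is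
non-dilating" — the shape in which L2-t3's `Thm37_ii` states it. [cite: MochizukiEtTh2009, Thm 3.7 (ii) p.79] -/
theorem isNonDilatingOn_divisorMonoid_iff :
    IsNonDilatingOn C₀.divisorMonoid ↔ ∀ (A : Dᵒᵖ) (f : A ⟶ A), IsNonDilating (C₀.Φ.pull f) := by
  constructor
  · intro h A f
    exact h (unop A) f.unop
  · intro h A α
    exact h (op A) α.op

/-! ### Thm 3.7 (i), "of birationally Frobenius-normalized type", in the tree's [FrdI] Def 4.5 (i) vocabulary -/

/-- **Thm 3.7 (i), clause "birationally Frobenius-normalized type"** ("it follows from [Mzk17], Theorem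
5.2, (ii), that `C` is of isotropic and model [hence birationally Frobenius-normalized] type", p. 306):
given that `C → F_Φ` is a Frobenioid (`hF`, [FrdI] Thm 5.2 (ii)) and the standing hypotheses of Thm 5.2,
every object of the tempered Frobenioid is birationally Frobenius-normalized at THE birationalization
`C^birat` ([FrdI] Def 4.5 (i) in abc-iut-L1-t3's `PreFrobenioidData.IsOfBiratFrobeniusNormalizedType` at
`PreFrobenioid.biratData`) — L1-d10's PROVED `ModelFrobenioid.isOfBiratFrobeniusNormalizedType_of_isDivisorial`.
[cite: MochizukiEtTh2009, Thm 3.7 (i) p.79] -/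
theorem isOfBiratFrobeniusNormalizedType_of
    (hyp : ModelFrobenioid.Hypotheses C₀.divisorMonoid C₀.ratFnFunctor)
    (hF : PreFrobenioid.IsFrobenioid C₀.toElem) :
    PreFrobenioidData.IsOfBiratFrobeniusNormalizedType
      (PreFrobenioid.biratData hF (PreFrobenioid.hasBiratSquares_of_isFrobenioid hF)) :=
  ModelFrobenioid.isOfBiratFrobeniusNormalizedType_of_isDivisorial hF
    (PreFrobenioid.hasBiratSquares_of_isFrobenioid hF) hyp.isDivisorial hyp.isGroupLike_rat

end General

/-! ## At the canonical [FrdI] vocabulary `treeCatVocab` -/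

section TreeVocab

variable {IsRational IsStrictlyRational : (Dᵒᵖ ⥤ CommMonCat.{w}) → Prop}
  (C₀ : TemperedFrobenioid T D (treeCatVocab D IsRational IsStrictlyRational))

/-- At the canonical vocabulary, the standing hypotheses of [FrdI] Thm 5.2 for the data
`(D, Φ, B, B → Φ^gp)` of Def 3.6 (ii) HOLD modulo the single residual datum `hBmon : IsMonoidOn B`:
`Φ` is a divisorial monoid on `D` (field `isDivisorialOn` read through `treeCatVocab`), `B` is
group-like (`RealifiedDivisorMonoids.isUnit_BΛ`), `D` is connected and totally epimorphic (fields).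
[cite: MochizukiEtTh2009, Def 3.6 p.77] -/
theorem hypotheses_treeCatVocab (hBmon : IsMonoidOn C₀.ratFnFunctor) :
    ModelFrobenioid.Hypotheses C₀.divisorMonoid C₀.ratFnFunctor :=
  haveI := C₀.isConnected
  { isMonoidOn := C₀.isMonoidOn_divisorMonoid
    isDivisorial := C₀.isDivisorial_divisorMonoid
    isMonoidOn_rat := hBmon
    isGroupLike_rat := C₀.ratFnFunctor_isGroupLike_holds
    isGraphConnected := (isGraphConnected_iff_isConnected (C := D)).2 inferInstance
    isTotallyEpimorphic := C₀.isTotallyEpimorphic }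

/-- **Thm 3.7 (ii), first clause, at the canonical vocabulary** — inputs `hBmon` ([FrdI] Thm 5.2
preamble: `B` a monoid on `D`), `hD` (`D` of FSMFF-type) and `hnd` (`Φ` non-dilating) only: the
tempered Frobenioid `C` is of standard type. [cite: MochizukiEtTh2009, Thm 3.7 (ii) p.79] -/
theorem isOfStandardType_treeCatVocab (hBmon : IsMonoidOn C₀.ratFnFunctor) (hD : IsOfFSMFFType D)
    (hnd : IsNonDilatingOn C₀.divisorMonoid) :
    (ModelFrobenioid.data C₀.divisorMonoid C₀.ratFnFunctor C₀.divBNatTrans).IsOfStandardType :=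
  C₀.isOfStandardType_of (C₀.hypotheses_treeCatVocab hBmon) hD hnd

/-- … and the equivalence form at the canonical vocabulary. [cite: MochizukiEtTh2009, Thm 3.7 (ii) p.79] -/
theorem isOfStandardType_treeCatVocab_iff (hBmon : IsMonoidOn C₀.ratFnFunctor) :
    (ModelFrobenioid.data C₀.divisorMonoid C₀.ratFnFunctor C₀.divBNatTrans).IsOfStandardType ↔
      IsOfFSMFFType D ∧ IsNonDilatingOn C₀.divisorMonoid :=
  C₀.isOfStandardType_iff (C₀.hypotheses_treeCatVocab hBmon)

/-- **Thm 3.7 (i), clause "birationally Frobenius-normalized type", at the canonical vocabulary** —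
input `hBmon` only (`hF` is then L1's [FrdI] Thm 5.2 (ii), `isFrobenioid_treeCatVocab_of_isMonoidOn`).
[cite: MochizukiEtTh2009, Thm 3.7 (i) p.79] -/
theorem isOfBiratFrobeniusNormalizedType_treeCatVocab (hBmon : IsMonoidOn C₀.ratFnFunctor) :
    PreFrobenioidData.IsOfBiratFrobeniusNormalizedType
      (PreFrobenioid.biratData (C₀.isFrobenioid_treeCatVocab_of_isMonoidOn hBmon)
        (PreFrobenioid.hasBiratSquares_of_isFrobenioid
          (C₀.isFrobenioid_treeCatVocab_of_isMonoidOn hBmon))) :=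
  C₀.isOfBiratFrobeniusNormalizedType_of (C₀.hypotheses_treeCatVocab hBmon)
    (C₀.isFrobenioid_treeCatVocab_of_isMonoidOn hBmon)

end TreeVocab

/-! ## The non-dilating hypothesis at the canonical monoid vocabulary `treeMonoidVocab` -/

section TreeMonoidVocab

variable {T' : RealifiedDivisorMonoids (D₀ := D₀) treeMonoidVocab.{w}} {VD : FrdICatStub.{u, v, w} D}
  (C₀ : TemperedFrobenioid T' D VD)

/-- At the canonical monoid vocabulary `treeMonoidVocab` ("non-dilating" = the tree's
`Frobenioids.IsNonDilating`), the hypothesis of L2-t3's `Thm37_ii` —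
`∀ (A : Dᵒᵖ) (f : A ⟶ A), V.IsNonDilating (Φ(A)) (Φ.pull f)` — IS the tree's `IsNonDilatingOn Φ`.
[cite: MochizukiEtTh2009, Thm 3.7 (ii) p.79] -/
theorem isNonDilatingOn_iff_pull :
    IsNonDilatingOn C₀.divisorMonoid ↔
      ∀ (A : Dᵒᵖ) (f : A ⟶ A), treeMonoidVocab.IsNonDilating (C₀.Φ.carrier A) (C₀.Φ.pull f) :=
  C₀.isNonDilatingOn_divisorMonoid_iff

end TreeMonoidVocab

end TemperedFrobenioid

end Literature.AnabelianGeometry.EtaleTheta
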